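import Summits.ResolutionOfSingularities.ResolutionOfSingularities.Theorems.FrobeniusLadderFInjectiveMacaulayficationPinchStrictTransformChart
import HarnessLib

/-!
# (T-I3, habitat #3a centre side) THE PINCH MODEL `C = Λ[x′, y]/(x′² + y²·g)`: BLOWING UP `J = (x′, y)·C` GIVES A REGULAR SCHEME (`Λ` regular ∋ ½, `V(g)` smooth pointwise,
# `Λ/(g)` a domain) — the strict transforms `T₀² + g` and `1 + T₁²·g` are NOT of graph type, so `StrictTransformGraphType` is extended by a general-`H` chart lemma
# (crux `FInjectiveMacaulayfication` stmt-ResolutionOfSingularities-15315, chain w45a; `Lines/T-I3-firststep.md` §3 #3a «a 2-generator strict-transform package for c₀² = −c₁²·w»;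
# seat res-L1-w45a-lead-1 g11)

[OURS · L1 W4.5a] Support file (`--supports stmt-ResolutionOfSingularities-15315 --as helper`); def-free; UNCONDITIONAL; no named fact; NOT a statement of any manuscript. Commutative
algebra + one scheme sentence; a tool for the next T″ habitat (the point floor of `x² + F₄` is `x′² + y²·w` chartwise, singular along `V(x′, y)`; its blowing up along `(x′, y)`
is regular). Evidence for nothing beyond itself; T″ and the F-half OPEN; nothing of the crux proved. AI-written (AI review is weaker than expert review).

* (general-`H` chart lemmas and the exceptional parts: ✓/⧗ `PinchStrictTransformChart`.)
* §1 the pinch model `R = Λ[T₀, T₁]`, `cen = ![T₀, T₁]`, `h = T₀² + T₁²·C g`: quasi-regularity, `R/I ≃ Λ`, the chart identities `h/1 = (T₁/1)²(frac² + C g)`, `h/1 = (T₀/1)²(1 + frac²·C g)`,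
  the open parts (`hoff_zero`, `hoff_one`: Jacobian with `∂_{T₀} h = 2T₀` and coefficientwise derivations), the exceptional parts (`Λ[T]/(T² + g)`, `Λ[T]/(1 + T²g)` regular).
* §2 ★★ `isRegularRing_blowupAlgebra_pinch` (both chart rings of `Bl_J Spec C` regular), ★★ `isRegular_affineBlowup_pinch`.
[folklore; cite: Liu2002, Thm. 8.1.19 (a)] [cite: StacksProject, Tag 0BIQ; Tag 07Z3; Tag 07PF] [cite: GortzWedhorn2020, Prop. 13.96 (2), Prop. 13.91 (4)]
-/

-- single-problem summit: the doubled namespace component is forced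
set_option linter.dupNamespace false

noncomputable section

namespace Summit.ResolutionOfSingularities.ResolutionOfSingularities.Theorems.FInjectiveMacaulayfication.PinchStrictTransform

open MvPolynomial Literature.AlgebraicGeometry.Resolution AlgebraicGeometry
open Summit.ResolutionOfSingularities.ResolutionOfSingularities.Theorems.FInjectiveMacaulayfication
open Summit.ResolutionOfSingularities.ResolutionOfSingularities.Cruxes.EquisingularLiftNat.Sections (prime_algebraMap_of_isQuasiRegular)
open Summit.ResolutionOfSingularities.ResolutionOfSingularities.Theorems.EquisingularLift.SpecimenQuartic (isRegularRing_quotient_of_derivations)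
open StrictTransformGraphType PinchStrictTransformChart

universe u v

/-! ## §1 The pinch model `R = Λ[T₀, T₁]`, `cen = ![T₀, T₁]`, `h = T₀² + T₁²·C g` -/

section model

variable {Λ : Type u} [CommRing Λ] (g : Λ) (cen : Fin 2 → MvPolynomial (Fin 2) Λ) (h : MvPolynomial (Fin 2) Λ)

/-- The values of the centre. [plumbing] -/
theorem cen_apply (hcen : cen = ![X 0, X 1]) : cen 0 = X 0 ∧ cen 1 = X 1 := by subst hcen; exact ⟨rfl, rfl⟩

/-- `(T₀, T₁) = (X '' univ)`. [plumbing] -/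
theorem span_range_cen_eq (hcen : cen = ![X 0, X 1]) :
    Ideal.span (Set.range cen) = Ideal.span (X '' (Set.univ : Set (Fin 2)) : Set (MvPolynomial (Fin 2) Λ)) := by
  subst hcen
  congr 1
  ext q
  simp only [Set.mem_range, Set.mem_image, Set.mem_univ, true_and]
  constructor
  · rintro ⟨j, rfl⟩
    fin_cases j
    · exact ⟨0, rfl⟩
    · exact ⟨1, rfl⟩
  · rintro ⟨j, rfl⟩
    fin_cases j
    · exact ⟨0, rfl⟩
    · exact ⟨1, rfl⟩

/-- **The variables form a weakly regular sequence.** [folklore; cite: Matsumura1987, Thm. 16.1] -/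
theorem isWeaklyRegular_cen (hcen : cen = ![X 0, X 1]) : RingTheory.Sequence.IsWeaklyRegular (MvPolynomial (Fin 2) Λ) (List.ofFn cen) := by
  subst hcen
  have hl : List.ofFn (![X 0, X 1] : Fin 2 → MvPolynomial (Fin 2) Λ) = [X 0, X 1] := rfl
  rw [hl]
  exact MvPolynomial.isWeaklyRegular_map_X (R := Λ) (τ := Fin 2) [0, 1] (by decide)

/-- ★ **The centre `(T₀, T₁)` is quasi-regular.** [cite: Matsumura1987, Thm. 16.2 (i)] -/
theorem isQuasiRegular_cen (hcen : cen = ![X 0, X 1]) : IsQuasiRegular cen :=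
  isQuasiRegular_of_isWeaklyRegular cen (isWeaklyRegular_cen cen hcen)

/-- **`R/I ≃+* Λ`**, `C λ ↦ λ`. [folklore] -/
theorem exists_ringEquiv_quotient (hcen : cen = ![X 0, X 1]) :
    ∃ e : (MvPolynomial (Fin 2) Λ ⧸ Ideal.span (Set.range cen)) ≃+* Λ, ∀ c : Λ, e (Ideal.Quotient.mk _ (C c)) = c := by
  haveI : IsEmpty {j : Fin 2 // j ∉ (Set.univ : Set (Fin 2))} := ⟨fun j => j.2 (Set.mem_univ _)⟩
  let e1 := Ideal.quotEquivOfEq (span_range_cen_eq cen hcen)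
  let e2 := (MvPolynomial.quotientSpanXEquiv (R := Λ) (Set.univ : Set (Fin 2))).toRingEquiv
  let e3 := (MvPolynomial.isEmptyAlgEquiv Λ {j : Fin 2 // j ∉ (Set.univ : Set (Fin 2))}).toRingEquiv
  refine ⟨e1.trans (e2.trans e3), fun c => ?_⟩
  rw [RingEquiv.trans_apply, RingEquiv.trans_apply]
  change e3 (MvPolynomial.quotientSpanXEquiv (R := Λ) (Set.univ : Set (Fin 2)) (Ideal.Quotient.mk _ (C c))) = _
  rw [MvPolynomial.quotientSpanXEquiv_mk_C]
  change MvPolynomial.isEmptyAlgEquiv Λ _ (C c) = _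
  rw [← MvPolynomial.algebraMap_eq, AlgEquiv.commutes]
  rfl

/-- `R/I` is a domain when `Λ` is. [folklore] -/
theorem isDomain_quotient (hcen : cen = ![X 0, X 1]) [IsDomain Λ] : IsDomain (MvPolynomial (Fin 2) Λ ⧸ Ideal.span (Set.range cen)) := by
  obtain ⟨e, -⟩ := exists_ringEquiv_quotient cen hcen
  exact e.toMulEquiv.isDomain

/-- `R/I` is a regular ring when `Λ` is. [folklore] -/
theorem isRegularRing_quotient (hcen : cen = ![X 0, X 1]) [IsRegularRing Λ] : IsRegularRing (MvPolynomial (Fin 2) Λ ⧸ Ideal.span (Set.range cen)) := by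
  obtain ⟨e, -⟩ := exists_ringEquiv_quotient cen hcen
  exact IsRegularRing.of_ringEquiv (R := Λ) e.symm

/-- `I ≠ R` when `Λ` is nontrivial. [plumbing] -/
theorem span_range_cen_ne_top (hcen : cen = ![X 0, X 1]) [Nontrivial Λ] : Ideal.span (Set.range cen) ≠ ⊤ := by
  obtain ⟨e, -⟩ := exists_ringEquiv_quotient cen hcen
  intro htop
  haveI : Subsingleton (MvPolynomial (Fin 2) Λ ⧸ Ideal.span (Set.range cen)) := Ideal.Quotient.subsingleton_iff.mpr htop
  exact not_subsingleton Λ e.symm.subsingleton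

/-! ### The two strict transforms -/

/-- On the chart `T₁`: `h/1 = (T₁/1)² · ((T₀/T₁)² + C g)`. [folklore] -/
theorem algebraMap_h_one (hcen : cen = ![X 0, X 1]) (hh : h = X 0 ^ 2 + X 1 ^ 2 * C g) :
    algebraMap (MvPolynomial (Fin 2) Λ) (blowupAlgebra (Ideal.span (Set.range cen)) (cen 1)) h =
      algebraMap (MvPolynomial (Fin 2) Λ) (blowupAlgebra (Ideal.span (Set.range cen)) (cen 1)) (cen 1) ^ 2 *
        (blowupAlgebra.frac cen 1 0 ^ 2 + algebraMap (MvPolynomial (Fin 2) Λ) (blowupAlgebra (Ideal.span (Set.range cen)) (cen 1)) (C g)) := by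
  obtain ⟨h0, h1⟩ := cen_apply cen hcen
  have e0 := blowupAlgebra.algebraMap_mul_gen (Ideal.span (Set.range cen)) (cen 1) (cen 0) (blowupAlgebra.mem_span_range cen 0)
  rw [hh, ← h0, ← h1, map_add, map_mul, map_pow, map_pow, ← e0]
  change _ = _ * (blowupAlgebra.gen _ _ _ _ ^ 2 + _)
  ring

/-- On the chart `T₀`: `h/1 = (T₀/1)² · (1 + (T₁/T₀)² · C g)`. [folklore] -/
theorem algebraMap_h_zero (hcen : cen = ![X 0, X 1]) (hh : h = X 0 ^ 2 + X 1 ^ 2 * C g) :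
    algebraMap (MvPolynomial (Fin 2) Λ) (blowupAlgebra (Ideal.span (Set.range cen)) (cen 0)) h =
      algebraMap (MvPolynomial (Fin 2) Λ) (blowupAlgebra (Ideal.span (Set.range cen)) (cen 0)) (cen 0) ^ 2 *
        (1 + blowupAlgebra.frac cen 0 1 ^ 2 * algebraMap (MvPolynomial (Fin 2) Λ) (blowupAlgebra (Ideal.span (Set.range cen)) (cen 0)) (C g)) := by
  obtain ⟨h0, h1⟩ := cen_apply cen hcen
  have e1 := blowupAlgebra.algebraMap_mul_gen (Ideal.span (Set.range cen)) (cen 0) (cen 1) (blowupAlgebra.mem_span_range cen 1)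
  rw [hh, ← h0, ← h1, map_add, map_mul, map_pow, map_pow, ← e1]
  change _ = _ * (1 + blowupAlgebra.gen _ _ _ _ ^ 2 * _)
  ring

/-- The strict transform on the chart `T₁` as `eval (T₀² + C(C g))`. [plumbing] -/
theorem eval_H_one :
    blowupAlgebra.eval cen 1 (X ⟨0, by decide⟩ ^ 2 + C (C g)) =
      blowupAlgebra.frac cen 1 0 ^ 2 + algebraMap (MvPolynomial (Fin 2) Λ) (blowupAlgebra (Ideal.span (Set.range cen)) (cen 1)) (C g) := by
  rw [map_add, map_pow, blowupAlgebra.eval_X, blowupAlgebra.eval_C]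

/-- The strict transform on the chart `T₀` as `eval (1 + T₁²·C(C g))`. [plumbing] -/
theorem eval_H_zero :
    blowupAlgebra.eval cen 0 (1 + X ⟨1, by decide⟩ ^ 2 * C (C g)) =
      1 + blowupAlgebra.frac cen 0 1 ^ 2 * algebraMap (MvPolynomial (Fin 2) Λ) (blowupAlgebra (Ideal.span (Set.range cen)) (cen 0)) (C g) := by
  rw [map_add, map_one, map_mul, map_pow, blowupAlgebra.eval_X, blowupAlgebra.eval_C]

/-- `h′₁ ∉ (T₁/1)` (coefficient test: the `T₀²`-coefficient is `1 ∉ I`). [cite: StacksProject, Tag 0BIQ] -/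
theorem eval_H_one_not_mem (hcen : cen = ![X 0, X 1]) [Nontrivial Λ] :
    blowupAlgebra.eval cen 1 (X ⟨0, by decide⟩ ^ 2 + C (C g)) ∉
      Ideal.span {algebraMap (MvPolynomial (Fin 2) Λ) (blowupAlgebra (Ideal.span (Set.range cen)) (cen 1)) (cen 1)} := by
  intro hmem
  rw [blowupAlgebra.eval_mem_span_algebraMap_iff cen 1 (isQuasiRegular_cen cen hcen)] at hmem
  have h1 := hmem (Finsupp.single ⟨0, by decide⟩ 2)
  rw [coeff_add, coeff_X_pow, if_pos rfl, coeff_C, if_neg (Ne.symm (Finsupp.single_ne_zero.mpr (by norm_num))), add_zero] at h1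
  exact span_range_cen_ne_top cen hcen ((Ideal.eq_top_iff_one _).mpr h1)

/-- `h′₀ ∉ (T₀/1)` (coefficient test: the constant coefficient is `1 ∉ I`). [cite: StacksProject, Tag 0BIQ] -/
theorem eval_H_zero_not_mem (hcen : cen = ![X 0, X 1]) [Nontrivial Λ] :
    blowupAlgebra.eval cen 0 (1 + X ⟨1, by decide⟩ ^ 2 * C (C g)) ∉
      Ideal.span {algebraMap (MvPolynomial (Fin 2) Λ) (blowupAlgebra (Ideal.span (Set.range cen)) (cen 0)) (cen 0)} := by
  intro hmem
  rw [blowupAlgebra.eval_mem_span_algebraMap_iff cen 0 (isQuasiRegular_cen cen hcen)] at hmem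
  have h1 := hmem 0
  rw [coeff_add, coeff_zero_one, mul_comm, C_mul_X_pow_eq_monomial, coeff_monomial, if_neg (Finsupp.single_ne_zero.mpr (by norm_num)), add_zero] at h1
  exact span_range_cen_ne_top cen hcen ((Ideal.eq_top_iff_one _).mpr h1)

/-! ### The open parts -/

/-- `∂_{T₀} h = 2T₀`. [plumbing] -/
theorem pderiv_zero_h (hh : h = X 0 ^ 2 + X 1 ^ 2 * C g) :
    (pderiv 0 : Derivation Λ (MvPolynomial (Fin 2) Λ) (MvPolynomial (Fin 2) Λ)) h = 2 * X 0 := by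
  subst hh
  simp only [map_add, Derivation.leibniz, Derivation.leibniz_pow, pderiv_X_self, pderiv_X_of_ne (show (1 : Fin 2) ≠ 0 by decide), pderiv_C, smul_zero,
    add_zero, smul_eq_mul, mul_one, nsmul_eq_mul, mul_zero]
  push_cast; ring

/-- `D̃₀ h = T₁² · C(D₀ g)` for the coefficientwise extension of a derivation `D₀` of `Λ`. [plumbing] -/
theorem coeffwiseDerivation_h {S₀ : Type v} [CommRing S₀] [Algebra S₀ Λ] (D₀ : Derivation S₀ Λ Λ) (hh : h = X 0 ^ 2 + X 1 ^ 2 * C g) :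
    coeffwiseDerivation (ι := Fin 2) D₀ h = X 1 ^ 2 * C (D₀ g) := by
  subst hh
  simp only [map_add, Derivation.leibniz, Derivation.leibniz_pow, coeffwiseDerivation_X, coeffwiseDerivation_C, smul_eq_mul, mul_zero,
    smul_zero, add_zero, zero_add]

/-- ★ **`hoff` on the chart `T₁`**: `R[1/T₁]/(h)` is a regular ring (`Λ` regular ∋ ½, pointwise derivations on `V(g)`): at `Q ∋ h`: if `T₀ ∉ Q` use `∂_{T₀}h = 2T₀`; else `C g ∈ Q`
(`T₁` is a unit), and the coefficientwise extension of a `D` with `D g ∉ Q ∩ Λ` has value `T₁²·C(D g) ∉ Q`. [folklore; cite: StacksProject, Tag 07PF] -/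
theorem hoff_one [IsRegularRing Λ] (h2 : IsUnit (2 : Λ)) {S₀ : Type v} [CommRing S₀] [Algebra S₀ Λ]
    (hD : ∀ Q : Ideal Λ, Q.IsPrime → g ∈ Q → ∃ D : Derivation S₀ Λ Λ, D g ∉ Q) (hcen : cen = ![X 0, X 1]) (hh : h = X 0 ^ 2 + X 1 ^ 2 * C g) :
    IsRegularRing (Localization.Away (cen 1) ⧸ Ideal.span {algebraMap (MvPolynomial (Fin 2) Λ) (Localization.Away (cen 1)) h}) := by
  obtain ⟨-, h1⟩ := cen_apply cen hcen
  refine ODPCurveBlowupRegular.isRegularRing_localization_quotient_of_derivations (S₀ := S₀) (Submonoid.powers (cen 1)) h fun Q hQ hhQ => ?_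
  have hu1 : IsUnit (algebraMap (MvPolynomial (Fin 2) Λ) (Localization.Away (cen 1)) (X 1)) := by
    rw [← h1]; exact IsLocalization.Away.algebraMap_isUnit (cen 1)
  by_cases hX0 : algebraMap (MvPolynomial (Fin 2) Λ) (Localization.Away (cen 1)) (X 0) ∈ Q
  · -- `C g ∈ Q`
    have hgQ : algebraMap (MvPolynomial (Fin 2) Λ) (Localization.Away (cen 1)) (C g) ∈ Q := by
      have hsq : algebraMap (MvPolynomial (Fin 2) Λ) (Localization.Away (cen 1)) (X 1 ^ 2 * C g) ∈ Q := by
        have e : algebraMap (MvPolynomial (Fin 2) Λ) (Localization.Away (cen 1)) (X 1 ^ 2 * C g) =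
            algebraMap (MvPolynomial (Fin 2) Λ) (Localization.Away (cen 1)) h -
              algebraMap (MvPolynomial (Fin 2) Λ) (Localization.Away (cen 1)) (X 0) ^ 2 := by
          rw [hh, map_add, map_pow]; ring
        rw [e]
        exact Q.sub_mem hhQ (Q.pow_mem_of_mem hX0 2 (by norm_num))
      rw [map_mul, map_pow] at hsq
      exact (hQ.mem_or_mem hsq).resolve_left (ODPCurveBlowupRegular.not_mem_of_isUnit hQ (hu1.pow 2))
    haveI : (Q.comap ((algebraMap (MvPolynomial (Fin 2) Λ) (Localization.Away (cen 1))).comp C)).IsPrime := Ideal.comap_isPrime _ Q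
    obtain ⟨D, hDg⟩ := hD (Q.comap ((algebraMap (MvPolynomial (Fin 2) Λ) (Localization.Away (cen 1))).comp C)) inferInstance
      (by rw [Ideal.mem_comap, RingHom.comp_apply]; exact hgQ)
    refine ⟨coeffwiseDerivation (ι := Fin 2) D, ?_⟩
    rw [coeffwiseDerivation_h g h D hh, map_mul, map_pow]
    intro hmem
    have hDg' : algebraMap (MvPolynomial (Fin 2) Λ) (Localization.Away (cen 1)) (C (D g)) ∈ Q :=
      (hQ.mem_or_mem hmem).resolve_left (ODPCurveBlowupRegular.not_mem_of_isUnit hQ (hu1.pow 2))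
    exact hDg (by rw [Ideal.mem_comap, RingHom.comp_apply]; exact hDg')
  · refine ⟨(pderiv 0 : Derivation Λ (MvPolynomial (Fin 2) Λ) (MvPolynomial (Fin 2) Λ)).restrictScalars S₀, ?_⟩
    rw [Derivation.restrictScalars_apply, pderiv_zero_h g h hh, map_mul]
    intro hmem
    have hu2 : IsUnit (algebraMap (MvPolynomial (Fin 2) Λ) (Localization.Away (cen 1)) 2) := by
      rw [show (2 : MvPolynomial (Fin 2) Λ) = C (2 : Λ) by rw [map_ofNat]]; exact (h2.map C).map _
    exact hX0 ((hQ.mem_or_mem hmem).resolve_left (ODPCurveBlowupRegular.not_mem_of_isUnit hQ hu2))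

/-- **`hoff` on the chart `T₀`**: `R[1/T₀]/(h)` is a regular ring (`∂_{T₀} h = 2T₀` is a unit there). [folklore; cite: StacksProject, Tag 07PF] -/
theorem hoff_zero [IsRegularRing Λ] (h2 : IsUnit (2 : Λ)) (hcen : cen = ![X 0, X 1]) (hh : h = X 0 ^ 2 + X 1 ^ 2 * C g) :
    IsRegularRing (Localization.Away (cen 0) ⧸ Ideal.span {algebraMap (MvPolynomial (Fin 2) Λ) (Localization.Away (cen 0)) h}) := by
  obtain ⟨h0, -⟩ := cen_apply cen hcen
  refine ODPCurveBlowupRegular.isRegularRing_localization_quotient_of_derivations (S₀ := Λ) (Submonoid.powers (cen 0)) h fun Q hQ _ => ?_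
  refine ⟨pderiv 0, ?_⟩
  rw [pderiv_zero_h g h hh, map_mul]
  have hu0 : IsUnit (algebraMap (MvPolynomial (Fin 2) Λ) (Localization.Away (cen 0)) (X 0)) := by
    rw [← h0]; exact IsLocalization.Away.algebraMap_isUnit (cen 0)
  have hu2 : IsUnit (algebraMap (MvPolynomial (Fin 2) Λ) (Localization.Away (cen 0)) 2) := by
    rw [show (2 : MvPolynomial (Fin 2) Λ) = C (2 : Λ) by rw [map_ofNat]]; exact (h2.map C).map _
  exact ODPCurveBlowupRegular.not_mem_of_isUnit hQ (hu2.mul hu0)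

end model


/-! ## §2 The chart rings of `Bl_J Spec C` and the regularity of `Bl_J Spec C` -/

section charts

variable {Λ : Type u} [CommRing Λ] (g : Λ) (cen : Fin 2 → MvPolynomial (Fin 2) Λ) (h : MvPolynomial (Fin 2) Λ)

/-- In `L = R[1/x_p]`: `(h′_p)·L = (h)·L` when `h/1 = (x_p/1)²·h′_p` (`x_p/1` is a unit there). [plumbing] -/
theorem map_span_eq (p : Fin 2) (h' : blowupAlgebra (Ideal.span (Set.range cen)) (cen p))
    (hf : algebraMap (MvPolynomial (Fin 2) Λ) (blowupAlgebra (Ideal.span (Set.range cen)) (cen p)) h =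
      algebraMap (MvPolynomial (Fin 2) Λ) (blowupAlgebra (Ideal.span (Set.range cen)) (cen p)) (cen p) ^ 2 * h') :
    (Ideal.span {h'}).map (algebraMap (blowupAlgebra (Ideal.span (Set.range cen)) (cen p)) (Localization.Away (cen p))) =
      Ideal.span {algebraMap (MvPolynomial (Fin 2) Λ) (Localization.Away (cen p)) h} := by
  rw [Ideal.map_span, Set.image_singleton]
  have hc := congrArg (fun b : blowupAlgebra (Ideal.span (Set.range cen)) (cen p) => (b : Localization.Away (cen p))) hf
  simp only [Subalgebra.coe_algebraMap, Subalgebra.coe_mul, Subalgebra.coe_pow] at hc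
  rw [hc]
  exact (Ideal.span_singleton_mul_left_unit ((IsLocalization.Away.algebraMap_isUnit (cen p)).pow 2) _).symm

/-- **Open part of the chart `T₁`** in the chart lemma's form. [plumbing] -/
theorem isRegularRing_open_one [IsRegularRing Λ] (h2 : IsUnit (2 : Λ)) {S₀ : Type v} [CommRing S₀] [Algebra S₀ Λ]
    (hD : ∀ Q : Ideal Λ, Q.IsPrime → g ∈ Q → ∃ D : Derivation S₀ Λ Λ, D g ∉ Q) (hcen : cen = ![X 0, X 1]) (hh : h = X 0 ^ 2 + X 1 ^ 2 * C g) :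
    IsRegularRing (Localization.Away (cen 1) ⧸
      (Ideal.span {blowupAlgebra.eval cen 1 (X ⟨0, by decide⟩ ^ 2 + C (C g))}).map
        (algebraMap (blowupAlgebra (Ideal.span (Set.range cen)) (cen 1)) (Localization.Away (cen 1)))) := by
  rw [eval_H_one, map_span_eq cen h 1 _ (algebraMap_h_one g cen h hcen hh)]
  exact hoff_one g cen h h2 hD hcen hh

/-- **Open part of the chart `T₀`** in the chart lemma's form. [plumbing] -/
theorem isRegularRing_open_zero [IsRegularRing Λ] (h2 : IsUnit (2 : Λ)) (hcen : cen = ![X 0, X 1]) (hh : h = X 0 ^ 2 + X 1 ^ 2 * C g) :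
    IsRegularRing (Localization.Away (cen 0) ⧸
      (Ideal.span {blowupAlgebra.eval cen 0 (1 + X ⟨1, by decide⟩ ^ 2 * C (C g))}).map
        (algebraMap (blowupAlgebra (Ideal.span (Set.range cen)) (cen 0)) (Localization.Away (cen 0)))) := by
  rw [eval_H_zero, map_span_eq cen h 0 _ (algebraMap_h_zero g cen h hcen hh)]
  exact hoff_zero g cen h h2 hcen hh

/-- ★★ **The chart ring `R[I/T₁]/(h′₁)`, `h′₁ = (T₀/T₁)² + C g`, is a regular ring** (`Λ` a regular domain ∋ ½, pointwise derivations on `V(g)`): general-`H` chart lemma with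
exceptional part `Λ[T₀]/(T₀² + g)` and open part `R[1/T₁]/(h)`. [folklore; cite: Liu2002, Thm. 8.1.19 (a)] -/
theorem isRegularRing_chart_one [IsRegularRing Λ] [IsDomain Λ] (h2 : IsUnit (2 : Λ)) {S₀ : Type v} [CommRing S₀] [Algebra S₀ Λ]
    (hD : ∀ Q : Ideal Λ, Q.IsPrime → g ∈ Q → ∃ D : Derivation S₀ Λ Λ, D g ∉ Q) (hcen : cen = ![X 0, X 1]) (hh : h = X 0 ^ 2 + X 1 ^ 2 * C g) :
    IsRegularRing (blowupAlgebra (Ideal.span (Set.range cen)) (cen 1) ⧸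
      Ideal.span {blowupAlgebra.eval cen 1 (X ⟨0, by decide⟩ ^ 2 + C (C g))}) := by
  haveI := isDomain_quotient cen hcen
  obtain ⟨e, he⟩ := exists_ringEquiv_quotient cen hcen
  have hsymm : e.symm g = Ideal.Quotient.mk _ (C g) := by
    have h0 := congrArg e.symm (he g)
    rw [RingEquiv.symm_apply_apply] at h0
    exact h0.symm
  refine isRegularRing_quotient_eval_of_parts cen 1 (isQuasiRegular_cen cen hcen) _ (eval_H_one_not_mem g cen hcen)
    (isRegularRing_map_of_ringEquiv cen 1 e.symm _ _ ?_
      (isRegularRing_quotient_X_sq_add_C (A := Λ) h2 (S₀ := S₀) (⟨0, by decide⟩ : {j : Fin 2 // j ≠ 1}) g hD))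
    (isRegularRing_open_one g cen h h2 hD hcen hh)
  rw [map_add, map_add, map_pow, map_pow, map_X, map_X, map_C, map_C, RingEquiv.coe_toRingHom, hsymm]

/-- ★★ **The chart ring `R[I/T₀]/(h′₀)`, `h′₀ = 1 + (T₁/T₀)²·C g`, is a regular ring** (`Λ` a regular domain ∋ ½). [folklore; cite: Liu2002, Thm. 8.1.19 (a)] -/
theorem isRegularRing_chart_zero [IsRegularRing Λ] [IsDomain Λ] (h2 : IsUnit (2 : Λ)) (hcen : cen = ![X 0, X 1]) (hh : h = X 0 ^ 2 + X 1 ^ 2 * C g) :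
    IsRegularRing (blowupAlgebra (Ideal.span (Set.range cen)) (cen 0) ⧸
      Ideal.span {blowupAlgebra.eval cen 0 (1 + X ⟨1, by decide⟩ ^ 2 * C (C g))}) := by
  haveI := isDomain_quotient cen hcen
  obtain ⟨e, he⟩ := exists_ringEquiv_quotient cen hcen
  have hsymm : e.symm g = Ideal.Quotient.mk _ (C g) := by
    have h0 := congrArg e.symm (he g)
    rw [RingEquiv.symm_apply_apply] at h0
    exact h0.symm
  refine isRegularRing_quotient_eval_of_parts cen 0 (isQuasiRegular_cen cen hcen) _ (eval_H_zero_not_mem g cen hcen)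
    (isRegularRing_map_of_ringEquiv cen 0 e.symm _ _ ?_
      (isRegularRing_quotient_one_add_X_sq_mul_C (A := Λ) h2 (⟨1, by decide⟩ : {j : Fin 2 // j ≠ 0}) g))
    (isRegularRing_open_zero g cen h h2 hcen hh)
  rw [map_add, map_add, map_one, map_one, map_mul, map_mul, map_pow, map_pow, map_X, map_X, map_C, map_C, RingEquiv.coe_toRingHom, hsymm]

/-- **One chart of `Bl_J Spec C` from the corresponding strict-transform quotient** (`C = R/(h)`, `J = I·C`): `C[J/c̄_p] ≅ R[I/x_p]/(h′_p)`
(`BlowupAlgebraStrictTransform.quotientKerBlowupAlgebraMapEquiv`). [cite: GortzWedhorn2020, Prop. 13.96 (2)] -/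
theorem isRegularRing_blowupAlgebra_of_chart [IsDomain Λ] (hcen : cen = ![X 0, X 1]) (p : Fin 2) (h' : blowupAlgebra (Ideal.span (Set.range cen)) (cen p))
    (hf : algebraMap (MvPolynomial (Fin 2) Λ) (blowupAlgebra (Ideal.span (Set.range cen)) (cen p)) h =
      algebraMap (MvPolynomial (Fin 2) Λ) (blowupAlgebra (Ideal.span (Set.range cen)) (cen p)) (cen p) ^ 2 * h')
    (hnot : h' ∉ Ideal.span {algebraMap (MvPolynomial (Fin 2) Λ) (blowupAlgebra (Ideal.span (Set.range cen)) (cen p)) (cen p)})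
    (hr : IsRegularRing (blowupAlgebra (Ideal.span (Set.range cen)) (cen p) ⧸ Ideal.span {h'}))
    (J : Ideal (MvPolynomial (Fin 2) Λ ⧸ Ideal.span {h})) (hJ : J = (Ideal.span (Set.range cen)).map (Ideal.Quotient.mk (Ideal.span {h}))) :
    IsRegularRing (blowupAlgebra J (Ideal.Quotient.mk (Ideal.span {h}) (cen p))) := by
  haveI := isDomain_quotient cen hcen
  have hprime := prime_algebraMap_of_isQuasiRegular cen p (isQuasiRegular_cen cen hcen)
  have hndvd : ¬ algebraMap (MvPolynomial (Fin 2) Λ) (blowupAlgebra (Ideal.span (Set.range cen)) (cen p)) (cen p) ∣ h' :=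
    fun hd => hnot (Ideal.mem_span_singleton.mpr hd)
  subst hJ
  haveI := hr
  exact IsRegularRing.of_ringEquiv (R := blowupAlgebra (Ideal.span (Set.range cen)) (cen p) ⧸ Ideal.span {h'})
    (quotientKerBlowupAlgebraMapEquiv (Ideal.Quotient.mk (Ideal.span {h})) ((Ideal.span (Set.range cen)).map (Ideal.Quotient.mk (Ideal.span {h})))
      Ideal.Quotient.mk_surjective le_rfl le_rfl Ideal.mk_ker hf hprime hndvd)

/-- ★★ **BOTH CHART RINGS `C[J/x̄′]`, `C[J/ȳ]` OF THE BLOWING UP OF `C = Λ[x′, y]/(x′² + y²g)` ALONG `J = (x′, y)·C` ARE REGULAR RINGS** (`Λ` a regular domain ∋ ½, pointwise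
derivations on `V(g)`). [folklore; cite: Liu2002, Thm. 8.1.19 (a)] [cite: GortzWedhorn2020, Prop. 13.96 (2)] -/
theorem isRegularRing_blowupAlgebra_pinch [IsRegularRing Λ] [IsDomain Λ] (h2 : IsUnit (2 : Λ)) {S₀ : Type v} [CommRing S₀] [Algebra S₀ Λ]
    (hD : ∀ Q : Ideal Λ, Q.IsPrime → g ∈ Q → ∃ D : Derivation S₀ Λ Λ, D g ∉ Q) (hcen : cen = ![X 0, X 1]) (hh : h = X 0 ^ 2 + X 1 ^ 2 * C g)
    (J : Ideal (MvPolynomial (Fin 2) Λ ⧸ Ideal.span {h})) (hJ : J = (Ideal.span (Set.range cen)).map (Ideal.Quotient.mk (Ideal.span {h}))) :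
    IsRegularRing (blowupAlgebra J (Ideal.Quotient.mk (Ideal.span {h}) (cen 0))) ∧ IsRegularRing (blowupAlgebra J (Ideal.Quotient.mk (Ideal.span {h}) (cen 1))) := by
  refine ⟨isRegularRing_blowupAlgebra_of_chart cen h hcen 0 _ ?_ (eval_H_zero_not_mem g cen hcen) (isRegularRing_chart_zero g cen h h2 hcen hh) J hJ,
    isRegularRing_blowupAlgebra_of_chart cen h hcen 1 _ ?_ (eval_H_one_not_mem g cen hcen) (isRegularRing_chart_one g cen h h2 hD hcen hh) J hJ⟩
  · rw [eval_H_zero]; exact algebraMap_h_zero g cen h hcen hh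
  · rw [eval_H_one]; exact algebraMap_h_one g cen h hcen hh

/-- ★★ **THE BLOWING UP `Bl_J Spec C` OF THE PINCH MODEL IS A REGULAR SCHEME** (`C = Λ[x′, y]/(x′² + y²g)`, `J = (x′, y)·C`; `Λ` a regular domain ∋ ½, pointwise derivations on `V(g)`).
[folklore; cite: GortzWedhorn2020, Prop. 13.91 (4), (13.19)] -/
theorem isRegular_affineBlowup_pinch [IsRegularRing Λ] [IsDomain Λ] (h2 : IsUnit (2 : Λ)) {S₀ : Type v} [CommRing S₀] [Algebra S₀ Λ]
    (hD : ∀ Q : Ideal Λ, Q.IsPrime → g ∈ Q → ∃ D : Derivation S₀ Λ Λ, D g ∉ Q) (hcen : cen = ![X 0, X 1]) (hh : h = X 0 ^ 2 + X 1 ^ 2 * C g)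
    (J : Ideal (MvPolynomial (Fin 2) Λ ⧸ Ideal.span {h})) (hJ : J = (Ideal.span (Set.range cen)).map (Ideal.Quotient.mk (Ideal.span {h}))) :
    Scheme.IsRegular (affineBlowup J) := by
  obtain ⟨r0, r1⟩ := isRegularRing_blowupAlgebra_pinch g cen h h2 hD hcen hh J hJ
  have hJ' : J = Ideal.span (Set.range fun l : Fin 2 => Ideal.Quotient.mk (Ideal.span {h}) (cen l)) := by
    rw [hJ, Ideal.map_span, ← Set.range_comp]; rfl
  refine affineBlowup.isRegular_of_isRegularRing_blowupAlgebra_of_pow_le (I := J) (fun l : Fin 2 => Ideal.Quotient.mk (Ideal.span {h}) (cen l))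
    (fun l => by rw [hJ']; exact Ideal.subset_span ⟨l, rfl⟩) (N := 1) (by rw [← hJ']; exact le_of_eq (pow_succ' J 1)) fun l => ?_
  fin_cases l
  · exact r0
  · exact r1

end charts

end Summit.ResolutionOfSingularities.ResolutionOfSingularities.Theorems.FInjectiveMacaulayfication.PinchStrictTransform

end
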